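import Mathlib
import Summits.Parity.GeneralizedHardyLittlewood.Theses.LiouvilleShiftedTables
import Summits.Parity.GeneralizedHardyLittlewood.Theorems.TableChowla.Negative.HelsonLeverCalibration
import Summits.Parity.GeneralizedHardyLittlewood.Theorems.TableChowla.Negative.TableChowlaExceptionalSet

/-!
# `stub_inverse_primeCols` — the lever `InverseCM` of line `helson-kronecker-inverse` on the
# large prime columns is a theorem (r4 calibration T1)

Crux `LiouvilleShiftedTables.TableChowla` (stmt-Parity-14270), line `helson-kronecker-inverse`, lead
reshape r4. The lever `InverseCM` (`stub_inverse`) says that a near-extremal pair of `ℓ²`-unit test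
vectors for the shifted multiplication table `λ(ab+c)`, `a ∈ (⌊A⌋,⌊2A⌋]`, `b ≤ ⌊x/A⌋`, forces a
COMPLETELY MULTIPLICATIVE 1-bounded column weight `g` with near-trivial mean square
`∑_a ‖∑_{b ≤ y} g(b) λ(ab+c)‖²`. Without "completely multiplicative" this is the landed theorem
`Negative.inverseCM_without_CM` (delocalisation, `Negative.delocalise`).

Here the bilinear form of the hypothesis runs over the LARGE PRIME columns only,
`S = {p ≤ ⌊x/A⌋ : p prime, p² > ⌊x/A⌋}`. On `S` complete multiplicativity is no constraint: the
delocalised 1-bounded weight `t` on `S` extends to the completely multiplicative `g` with `g(p) = t_p`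
for `p ∈ S` and `g(p) = 0` at every other prime (`primeCols_exists_cm_extension`), and on `[1, ⌊x/A⌋]` this `g`
equals `t` on `S`, `1` at `b = 1` and `0` elsewhere (every other `b ≤ ⌊x/A⌋` has a prime factor `p`
with `p² ≤ ⌊x/A⌋`; `exists_cm_primeCols`). The single extra column `b = 1` costs at most
`#rows ≤ 2A`, absorbed by one more logarithm: `C' = 4C + 1`, `y = x/A`. No hypothesis on `c`.
-/

namespace Summit.Parity.GeneralizedHardyLittlewood.Theorems.TableChowla.HelsonKroneckerInverse

open Finset Real ArithmeticFunction
open Summit.Parity.GeneralizedHardyLittlewood.Theorems.TableChowla.Negative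

noncomputable section

/-- CM EXTENSION. Any real sequence `T` on the primes with `|T p| ≤ 1` is the restriction to the primes
of a completely multiplicative `g : ℕ → ℂ` with `‖g‖ ≤ 1` and `g 1 = 1` (namely
`g(n) = ∏_{p^k ‖ n} T(p)^k`, `g 0 = 0`). -/
theorem primeCols_exists_cm_extension (T : ℕ → ℝ) (hT : ∀ p : ℕ, |T p| ≤ 1) :
    ∃ g : ℕ → ℂ, (∀ m n : ℕ, g (m * n) = g m * g n) ∧ (∀ n : ℕ, ‖g n‖ ≤ 1) ∧ g 1 = 1 ∧
      ∀ p : ℕ, p.Prime → g p = (T p : ℂ) := by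
  refine ⟨fun n => if n = 0 then 0 else n.factorization.prod fun p k => ((T p : ℝ) : ℂ) ^ k,
    ?_, ?_, ?_, ?_⟩
  · intro m n
    rcases eq_or_ne m 0 with rfl | hm
    · simp
    rcases eq_or_ne n 0 with rfl | hn
    · simp
    dsimp only
    rw [if_neg hm, if_neg hn, if_neg (mul_ne_zero hm hn), Nat.factorization_mul hm hn,
      Finsupp.prod_add_index']
    · intro a
      exact pow_zero _
    · intro a b₁ b₂
      exact pow_add _ _ _
  · intro n
    dsimp only
    split_ifs with hn
    · simp
    · rw [Finsupp.prod, Complex.norm_prod]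
      refine prod_le_one (fun p _ => norm_nonneg _) (fun p _ => ?_)
      rw [norm_pow, Complex.norm_real, Real.norm_eq_abs]
      exact pow_le_one₀ (abs_nonneg _) (hT p)
  · simp
  · intro p hp
    dsimp only
    rw [if_neg hp.ne_zero, hp.factorization, Finsupp.prod_single_index] <;> simp

/-- COLUMN VALUES OF THE CM EXTENSION. For a 1-bounded real weight `t` and a column length `B ≥ 1`
there is a completely multiplicative 1-bounded `g : ℕ → ℂ` (`g(p) = t_p` at the primes `p² > B`,
`g(p) = 0` at the primes `p² ≤ B`) whose column sum over `[1, B]` against any real kernel `f` is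
`f(1) + ∑_{p ≤ B prime, p² > B} t_p f(p)`: every `b ∈ [2, B]` outside the large primes has a prime
factor `p` with `p² ≤ B`, so `g(b) = 0`. -/
theorem exists_cm_primeCols (B : ℕ) (t : ℕ → ℝ) (ht : ∀ b : ℕ, |t b| ≤ 1) :
    ∃ g : ℕ → ℂ, (∀ m n : ℕ, g (m * n) = g m * g n) ∧ (∀ n : ℕ, ‖g n‖ ≤ 1) ∧
      ∀ f : ℕ → ℝ, 1 ≤ B →
        ∑ b ∈ Icc 1 B, g b * (f b : ℂ) =
          ((f 1 + ∑ b ∈ (Icc 1 B).filter (fun b => b.Prime ∧ B < b * b), t b * f b : ℝ) : ℂ) := by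
  set T : ℕ → ℝ := fun p => if B < p * p then t p else 0 with hTdef
  have hT1 : ∀ p, |T p| ≤ 1 := by
    intro p
    simp only [hTdef]
    split_ifs
    · exact ht p
    · simp
  obtain ⟨g, hg_mul, hg_bd, hg1, hgp⟩ := primeCols_exists_cm_extension T hT1
  refine ⟨g, hg_mul, hg_bd, fun f hB => ?_⟩
  -- the values of `g` on the columns `[1, B]`
  have hval : ∀ b ∈ Icc 1 B,
      g b = ((if b = 1 then 1 else if b.Prime ∧ B < b * b then t b else 0 : ℝ) : ℂ) := by
    intro b hb
    have hb1 : 1 ≤ b := (mem_Icc.mp hb).1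
    have hbB : b ≤ B := (mem_Icc.mp hb).2
    by_cases h1 : b = 1
    · subst h1
      rw [if_pos rfl, hg1, Complex.ofReal_one]
    rw [if_neg h1]
    by_cases hP : b.Prime ∧ B < b * b
    · rw [if_pos hP, hgp b hP.1]
      simp only [hTdef]
      rw [if_pos hP.2]
    · rw [if_neg hP, Complex.ofReal_zero]
      -- `b` has a prime factor `p` with `p² ≤ B`, where `g` vanishes
      have hpp : b.minFac.Prime := Nat.minFac_prime h1
      have hpsmall : b.minFac * b.minFac ≤ B := by
        by_cases hbp : b.Prime
        · have hbb : ¬ B < b * b := fun h => hP ⟨hbp, h⟩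
          rw [hbp.minFac_eq]
          omega
        · have hsq := Nat.minFac_sq_le_self (by omega : 0 < b) hbp
          rw [sq] at hsq
          omega
      have hTp : T b.minFac = 0 := by
        simp only [hTdef]
        rw [if_neg (not_lt.mpr hpsmall)]
      calc g b = g (b.minFac * (b / b.minFac)) := by rw [Nat.mul_div_cancel' (Nat.minFac_dvd b)]
        _ = g b.minFac * g (b / b.minFac) := hg_mul _ _
        _ = 0 := by rw [hgp _ hpp, hTp]; simp
  -- summing over the columns
  have h1mem : 1 ∈ Icc 1 B := by rw [mem_Icc]; exact ⟨le_rfl, hB⟩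
  have hpt : ∀ b ∈ Icc 1 B, g b * (f b : ℂ) =
      (((if b = 1 then f b else 0) + (if b.Prime ∧ B < b * b then t b * f b else 0) : ℝ) : ℂ) := by
    intro b hb
    rw [hval b hb, ← Complex.ofReal_mul]
    congr 1
    by_cases h1 : b = 1
    · subst h1
      have hn : ¬ ((1 : ℕ).Prime ∧ B < 1 * 1) := fun h => Nat.not_prime_one h.1
      rw [if_pos rfl, if_pos rfl, if_neg hn, one_mul, add_zero]
    · rw [if_neg h1, if_neg h1, zero_add, ite_mul, zero_mul]
  rw [sum_congr rfl hpt, ← Complex.ofReal_sum, sum_add_distrib, sum_ite_eq', if_pos h1mem,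
    sum_filter]

/-- Pointwise lower bound used row by row: `(E + X)² ≥ X²/2 − 1` when `|E| ≤ 1`
(`(E + X)² − X²/2 + E² = (2E + X)²/2 ≥ 0`). -/
theorem primeCols_sq_half_sub_one_le {E : ℝ} (X : ℝ) (hE : |E| ≤ 1) : X ^ 2 / 2 - 1 ≤ (E + X) ^ 2 := by
  have h0 := abs_nonneg E
  have h1 : E ^ 2 ≤ 1 := by rw [← sq_abs]; nlinarith
  nlinarith [sq_nonneg (2 * E + X)]

/-- NUMERICS of the final step: with `rows R ≤ 2A`, `A² ≤ x^{5/6}`, `4K⁴L ≤ x^{7/6}`, `L ≥ 128`,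
the delocalised mean square `M ≥ x²/(16K⁴R)` minus the cost `R` of the column `b = 1` still exceeds
`x(x/A)/(K⁴L)`. -/
theorem primeCols_final_numerics {x A K L R M N : ℝ} (hx : 0 < x) (hA : 0 < A) (hK : 0 < K) (hL : 128 ≤ L)
    (hR : 0 < R) (hRle : R ≤ 2 * A) (hA56 : A ^ 2 ≤ x ^ (5 / 6 : ℝ))
    (hev : 4 * (K ^ 4 * L) ≤ x ^ (7 / 6 : ℝ)) (hM : x ^ 2 / (16 * K ^ 4 * R) ≤ M)
    (hN : M / 2 - R ≤ N) : x * (x / A) / (K ^ 4 * L) ≤ N := by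
  have hLpos : 0 < L := by linarith
  have hx2 : x ^ (5 / 6 : ℝ) * x ^ (7 / 6 : ℝ) = x ^ 2 := by
    rw [← Real.rpow_add hx]
    norm_num
  have hPL : K ^ 4 * L ≤ x ^ (7 / 6 : ℝ) / 4 := by
    rw [le_div_iff₀ (by norm_num : (0 : ℝ) < 4)]
    linarith
  have hR128 : R * (128 * K ^ 4 * A) ≤ x ^ 2 :=
    calc R * (128 * K ^ 4 * A) ≤ (2 * A) * (128 * K ^ 4 * A) :=
          mul_le_mul_of_nonneg_right hRle (by positivity)
      _ = 2 * A ^ 2 * K ^ 4 * 128 := by ring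
      _ ≤ 2 * A ^ 2 * K ^ 4 * L := mul_le_mul_of_nonneg_left hL (by positivity)
      _ = 2 * A ^ 2 * (K ^ 4 * L) := by ring
      _ ≤ 2 * x ^ (5 / 6 : ℝ) * (x ^ (7 / 6 : ℝ) / 4) :=
          mul_le_mul (mul_le_mul_of_nonneg_left hA56 (by norm_num)) hPL (by positivity)
            (by positivity)
      _ = x ^ 2 / 2 := by rw [← hx2]; ring
      _ ≤ x ^ 2 := by linarith [sq_nonneg x]
  have h1 : x * (x / A) / (K ^ 4 * L) ≤ x ^ 2 / (128 * K ^ 4 * A) := by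
    rw [div_le_div_iff₀ (by positivity) (by positivity)]
    have h : x * (x / A) * (128 * K ^ 4 * A) = x ^ 2 * K ^ 4 * 128 := by
      rw [mul_div_assoc', div_mul_eq_mul_div, div_eq_iff hA.ne']
      ring
    rw [h]
    calc x ^ 2 * K ^ 4 * 128 ≤ x ^ 2 * K ^ 4 * L := mul_le_mul_of_nonneg_left hL (by positivity)
      _ = x ^ 2 * (K ^ 4 * L) := by ring
  have h2 : R ≤ x ^ 2 / (128 * K ^ 4 * A) := by
    rw [le_div_iff₀ (by positivity)]
    exact hR128
  have h3 : x ^ 2 / (128 * K ^ 4 * A) + x ^ 2 / (128 * K ^ 4 * A) ≤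
      x ^ 2 / (32 * K ^ 4 * R) := by
    have h64 : x ^ 2 / (128 * K ^ 4 * A) + x ^ 2 / (128 * K ^ 4 * A) =
        x ^ 2 / (64 * K ^ 4 * A) := by
      rw [← add_div, div_eq_div_iff (by positivity) (by positivity)]
      ring
    rw [h64]
    have h32 : 32 * K ^ 4 * R ≤ 64 * K ^ 4 * A := by
      have := mul_le_mul_of_nonneg_left hRle (by positivity : (0 : ℝ) ≤ 32 * K ^ 4)
      linarith
    exact div_le_div_of_nonneg_left (by positivity) (by positivity) h32
  have h4 : x ^ 2 / (32 * K ^ 4 * R) = x ^ 2 / (16 * K ^ 4 * R) / 2 := by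
    rw [div_div]
    congr 1
    ring
  linarith [h1, h2, h3, h4, hM, hN]

/-- **`stub_inverse_primeCols`** (r4 calibration T1 of line `helson-kronecker-inverse`, crux
stmt-Parity-14270): THE LEVER ON THE LARGE PRIME COLUMNS. If the bilinear form of the shifted table
`λ(ab+c)` restricted to the prime columns `p ∈ [1, ⌊x/A⌋]` with `p² > ⌊x/A⌋` is near-extremal,
`|∑_a ∑_p u_a v_p λ(ap+c)| ≥ √x/(log x)^C` for `ℓ²`-unit `u, v`, then a completely multiplicative
1-bounded column witness exists with `∑_a ‖∑_{b ≤ ⌊x/A⌋} g(b)λ(ab+c)‖² ≥ x(x/A)/(log x)^{4C+1}`: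
delocalise `v` on those primes (`Negative.delocalise` at `τ = 2(log x)^C√rows/√x`), extend the
resulting 1-bounded weight to a completely multiplicative `g` vanishing at the primes `p² ≤ ⌊x/A⌋`
(`exists_cm_primeCols`), whose column sums over `[1, ⌊x/A⌋]` are the delocalised prime-column sums
plus the single entry `λ(a+c)`. No hypothesis on `c`. -/
theorem stub_inverse_primeCols :
    ∀ c : ℤ, ∀ δ : ℝ, 0 < δ → δ ≤ 1 / 12 → ∀ C : ℝ, 0 < C → ∃ C' : ℝ, 0 < C' ∧ ∃ x₀ : ℝ,
    ∀ x : ℝ, x₀ ≤ x → ∀ A : ℝ, x ^ δ ≤ A → A ≤ x ^ (1 / 3 + δ) →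
    ∀ u v : ℕ → ℝ, (∑ a ∈ Finset.Ioc ⌊A⌋₊ ⌊2 * A⌋₊, u a ^ 2 ≤ 1) →
      (∑ b ∈ Finset.Icc 1 ⌊x / A⌋₊, v b ^ 2 ≤ 1) →
      x ^ (1 / 2 : ℝ) / Real.log x ^ C ≤
        |∑ a ∈ Finset.Ioc ⌊A⌋₊ ⌊2 * A⌋₊,
          ∑ b ∈ (Finset.Icc 1 ⌊x / A⌋₊).filter (fun b => b.Prime ∧ ⌊x / A⌋₊ < b * b),
            u a * v b * (ArithmeticFunction.liouville (Int.toNat ((a : ℤ) * b + c)) : ℝ)| →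
      ∃ g : ℕ → ℂ, (∀ m n : ℕ, g (m * n) = g m * g n) ∧ (∀ n : ℕ, ‖g n‖ ≤ 1) ∧
        ∃ y : ℝ, y ≤ x / A ∧
          x * (x / A) / Real.log x ^ C' ≤
            ∑ a ∈ Finset.Ioc ⌊A⌋₊ ⌊2 * A⌋₊,
              ‖∑ b ∈ Finset.Icc 1 ⌊y⌋₊, g b *
                ((ArithmeticFunction.liouville (Int.toNat ((a : ℤ) * b + c)) : ℝ) : ℂ)‖ ^ 2 := by
  intro c δ hδ hδ' C hC
  obtain ⟨X, hX⟩ := eventually_log_rpow_le (show (0 : ℝ) < 7 / 6 by norm_num) (4 * C + 1)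
  refine ⟨4 * C + 1, by linarith,
    max (max (max (Real.exp 8) ((2 : ℝ) ^ (1 / δ))) (Real.exp 128)) X, ?_⟩
  intro x hx A hA hA' u v hu hv hbig
  -- thresholds
  have hx1 : max (Real.exp 8) ((2 : ℝ) ^ (1 / δ)) ≤ x :=
    le_trans (le_trans (le_max_left _ _) (le_max_left _ _)) hx
  have hx128 : Real.exp 128 ≤ x := le_trans (le_trans (le_max_right _ _) (le_max_left _ _)) hx
  have hxX : X ≤ x := le_trans (le_max_right _ _) hx
  obtain ⟨hA2, hxA, -⟩ := window_lower hδ hδ' hx1 hA hA'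
  have hApos : 0 < A := by linarith
  have hxApos : 0 < x / A := by linarith
  have hxpos : 0 < x := by
    have := mul_pos hApos hxApos
    rwa [mul_div_cancel₀ _ hApos.ne'] at this
  have hxone : (1 : ℝ) ≤ x := by
    have := Real.add_one_le_exp (8 : ℝ)
    linarith [le_trans (le_max_left _ _) hx1]
  have hlog : 128 ≤ Real.log x := (Real.le_log_iff_exp_le hxpos).mpr hx128
  obtain ⟨hev, -⟩ := hX x hxX
  set L : ℝ := Real.log x with hL
  have hLpos : 0 < L := by linarith
  set K : ℝ := L ^ C with hK
  have hKpos : 0 < K := Real.rpow_pos_of_pos hLpos C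
  -- rows and columns
  set Rs : Finset ℕ := Ioc ⌊A⌋₊ ⌊2 * A⌋₊ with hRs
  set R : ℝ := (Rs.card : ℝ) with hRdef
  have hRle : R ≤ 2 * A := by
    rw [hRdef, hRs, Nat.card_Ioc, Nat.cast_sub (Nat.floor_le_floor (by linarith : A ≤ 2 * A))]
    have h1 : (⌊2 * A⌋₊ : ℝ) ≤ 2 * A := Nat.floor_le (by linarith)
    have h2 : A - 1 < (⌊A⌋₊ : ℝ) := by have := Nat.lt_floor_add_one A; linarith
    linarith
  have hRge : A / 2 ≤ R := by have := sub_one_le_card_rows hApos.le; rw [hRdef, hRs]; linarith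
  have hRpos : 0 < R := by linarith
  set Bn : ℕ := ⌊x / A⌋₊ with hBn
  have hB1 : 1 ≤ Bn := by
    rw [hBn]
    exact Nat.le_floor (by norm_num; linarith)
  set S : Finset ℕ := (Icc 1 Bn).filter (fun b => b.Prime ∧ Bn < b * b) with hS
  have hSsub : S ⊆ Icc 1 Bn := filter_subset _ _
  have hvS : ∑ b ∈ S, v b ^ 2 ≤ 1 :=
    le_trans (sum_le_sum_of_subset_of_nonneg hSsub fun b _ _ => sq_nonneg (v b)) hv
  -- the kernel `e(a,b) = λ(ab+c)`
  set e : ℕ → ℕ → ℝ := fun a b => (ArithmeticFunction.liouville (Int.toNat ((a : ℤ) * b + c)) : ℝ)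
    with he_def
  have he : ∀ a b, |e a b| ≤ 1 := fun a b => abs_lam_le_one _
  have hhalf2 : (x ^ (1 / 2 : ℝ)) ^ 2 = x := by
    rw [← Real.rpow_natCast, ← Real.rpow_mul hxpos.le]; norm_num
  have hhalfpos : 0 < x ^ (1 / 2 : ℝ) := Real.rpow_pos_of_pos hxpos _
  -- truncation height
  set τ : ℝ := 2 * K * Real.sqrt R / x ^ (1 / 2 : ℝ) with hτdef
  have hsR : 0 < Real.sqrt R := Real.sqrt_pos.mpr hRpos
  have hτpos : 0 < τ := by positivity
  have hRt : Real.sqrt R / τ = x ^ (1 / 2 : ℝ) / (2 * K) := by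
    rw [hτdef]; field_simp
  have hτ2 : τ ^ 2 = 4 * K ^ 2 * R / x := by
    rw [hτdef, div_pow, hhalf2, mul_pow, mul_pow, Real.sq_sqrt hRpos.le]; ring
  -- the form on the large prime columns
  set Fv : ℝ := ∑ a ∈ Rs, ∑ b ∈ S, u a * v b * e a b with hFv
  have hbig' : x ^ (1 / 2 : ℝ) / K ≤ |Fv| := hbig
  have hT : Real.sqrt R / τ ≤ |Fv| := by
    rw [hRt]
    have : x ^ (1 / 2 : ℝ) / (2 * K) ≤ x ^ (1 / 2 : ℝ) / K :=
      div_le_div_of_nonneg_left hhalfpos.le hKpos (by linarith)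
    exact this.trans hbig'
  have hdeloc := delocalise e he Rs S u v hu hvS hτpos hT
  -- the delocalised weight on the large primes and its row sums `X_a`
  set t : ℕ → ℝ := fun b => if |v b| ≤ τ then v b / τ else 0 with ht
  set Xr : ℕ → ℝ := fun a => ∑ b ∈ S, t b * e a b with hXr
  have hdeloc' : (|Fv| - Real.sqrt R / τ) ^ 2 / τ ^ 2 ≤ ∑ a ∈ Rs, Xr a ^ 2 := hdeloc
  have hstep2 : (x ^ (1 / 2 : ℝ) / (2 * K)) ^ 2 / τ ^ 2 = x ^ 2 / (16 * K ^ 4 * R) := by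
    rw [hτ2, div_pow, hhalf2]
    field_simp
    ring
  have hstep1 : (x ^ (1 / 2 : ℝ) / (2 * K)) ^ 2 / τ ^ 2 ≤ (|Fv| - Real.sqrt R / τ) ^ 2 / τ ^ 2 := by
    apply div_le_div_of_nonneg_right _ (by positivity)
    apply pow_le_pow_left₀ (by positivity)
    rw [hRt]
    have hsplit : x ^ (1 / 2 : ℝ) / K = x ^ (1 / 2 : ℝ) / (2 * K) + x ^ (1 / 2 : ℝ) / (2 * K) := by
      field_simp; ring
    linarith [hbig']
  have hXsq : x ^ 2 / (16 * K ^ 4 * R) ≤ ∑ a ∈ Rs, Xr a ^ 2 :=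
    hstep2.symm.le.trans (hstep1.trans hdeloc')
  -- the completely multiplicative witness: CM extension of `t` on the large primes
  obtain ⟨g, hg_mul, hg_bd, hgsum⟩ :=
    exists_cm_primeCols Bn t (fun b => abs_trunc_le_one v hτpos b)
  refine ⟨g, hg_mul, hg_bd, x / A, le_rfl, ?_⟩
  have hreal : ∀ a ∈ Rs, ‖∑ b ∈ Icc 1 Bn, g b * ((e a b : ℝ) : ℂ)‖ ^ 2 = (e a 1 + Xr a) ^ 2 := by
    intro a _
    rw [hgsum (e a) hB1, Complex.norm_real, Real.norm_eq_abs, sq_abs]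
  show x * (x / A) / L ^ (4 * C + 1) ≤ ∑ a ∈ Rs, ‖∑ b ∈ Icc 1 Bn, g b * ((e a b : ℝ) : ℂ)‖ ^ 2
  rw [sum_congr rfl hreal]
  -- `(e + X)² ≥ X²/2 − 1` summed over the rows
  have hms : (∑ a ∈ Rs, Xr a ^ 2) / 2 - R ≤ ∑ a ∈ Rs, (e a 1 + Xr a) ^ 2 := by
    have h := sum_le_sum fun a (_ : a ∈ Rs) => primeCols_sq_half_sub_one_le (Xr a) (he a 1)
    rw [sum_sub_distrib, sum_const, nsmul_eq_mul, mul_one, ← sum_div] at h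
    rw [hRdef]
    exact h
  -- sizes
  have hpow : L ^ (4 * C + 1) = K ^ 4 * L := by
    rw [Real.rpow_add hLpos, Real.rpow_one, mul_comm (4 : ℝ) C, Real.rpow_mul hLpos.le]
    congr 1
    rw [show (4 : ℝ) = ((4 : ℕ) : ℝ) by norm_num, Real.rpow_natCast]
  rw [hpow] at hev ⊢
  have hA56 : A ^ 2 ≤ x ^ (5 / 6 : ℝ) := by
    have h1 : A ≤ x ^ (5 / 12 : ℝ) :=
      hA'.trans (Real.rpow_le_rpow_of_exponent_le hxone (by linarith))
    calc A ^ 2 ≤ (x ^ (5 / 12 : ℝ)) ^ 2 := pow_le_pow_left₀ hApos.le h1 2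
      _ = x ^ (5 / 6 : ℝ) := by rw [← Real.rpow_natCast, ← Real.rpow_mul hxpos.le]; norm_num
  exact primeCols_final_numerics hxpos hApos hKpos hlog hRpos hRle hA56 hev hXsq hms

end

end Summit.Parity.GeneralizedHardyLittlewood.Theorems.TableChowla.HelsonKroneckerInverse
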